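import Mathlib

/-!
# Band-centre outgoing Green's function of the hopping chain on ℤ (solo-blind kernel #204)

For the nearest-neighbour hopping operator `(H ψ)(n) = ψ(n-1) + ψ(n+1)` on `ℤ` the sequence
`G(n) = (i/2) (-i)^{|n|}` is the *outgoing* Green's function at the band centre `E = 0`:
`G(n-1) + G(n+1) = δ_{n,0}`, it is even, and away from the origin it is a pure outgoing wave,
`G(n+1) = (-i) G(n)` for `n ≥ 0`.  Convolving with the local source `S = 2δ₀ - δ₂ - δ₋₂`
(the even extension of the streak injection `√2 e₀ - e₂`) gives the profile
`2G(n) - G(n-2) - G(n+2)`, whose values `i·… , 1, 2i(-i)^m` reproduce (up to the factor `-α`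
and the `√2` boundary normalisation) the flux state of `SoloBlindFluxState` (kernel #202).
These identities are the `ε → 0` skeleton of the frozen lattice-radiation problem behind LEMMA R
(architecture A5).
-/

namespace Summit.AnomalousDissipation.AnomalousDissipation.Theorems

open Complex

/-- The band-centre outgoing Green's function of the hopping chain on `ℤ`: `G(n) = (i/2)(-i)^{|n|}`. -/
noncomputable def bandCentreGreen (n : ℤ) : ℂ := (I / 2) * (-I) ^ n.natAbs

/-- `G` is even. -/
theorem bandCentreGreen_neg (n : ℤ) : bandCentreGreen (-n) = bandCentreGreen n := by
  simp [bandCentreGreen, Int.natAbs_neg]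

/-- Value at the origin: `G(0) = i/2`. -/
theorem bandCentreGreen_zero : bandCentreGreen 0 = I / 2 := by
  simp [bandCentreGreen]

/-- Outgoing recursion to the right: `G(n+1) = (-i)·G(n)` for `n ≥ 0`. -/
theorem bandCentreGreen_succ_of_nonneg {n : ℤ} (hn : 0 ≤ n) :
    bandCentreGreen (n + 1) = (-I) * bandCentreGreen n := by
  have h : (n + 1).natAbs = n.natAbs + 1 := by omega
  simp [bandCentreGreen, h, pow_succ]; ring

/-- Outgoing recursion to the left: `G(n-1) = (-i)·G(n)` for `n ≤ 0`. -/
theorem bandCentreGreen_pred_of_nonpos {n : ℤ} (hn : n ≤ 0) :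
    bandCentreGreen (n - 1) = (-I) * bandCentreGreen n := by
  have h : (n - 1).natAbs = n.natAbs + 1 := by omega
  simp [bandCentreGreen, h, pow_succ]; ring

/-- The Green's function identity at the band centre: `G(n-1) + G(n+1) = δ_{n,0}`. -/
theorem bandCentreGreen_eq (n : ℤ) :
    bandCentreGreen (n - 1) + bandCentreGreen (n + 1) = if n = 0 then 1 else 0 := by
  rcases lt_trichotomy n 0 with hlt | rfl | hgt
  · -- n ≤ -1: both neighbours on the left branch
    have h1 : (n - 1).natAbs = n.natAbs + 1 := by omega
    have h2 : (n + 1).natAbs + 1 = n.natAbs := by omega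
    have hne : n ≠ 0 := ne_of_lt hlt
    simp only [bandCentreGreen, hne, if_false]
    rw [h1, ← h2, pow_succ, pow_succ]
    have hI : (-I) * (-I) = -1 := by rw [neg_mul_neg, I_mul_I]
    calc I / 2 * ((-I) ^ (n + 1).natAbs * -I * -I) + I / 2 * (-I) ^ (n + 1).natAbs
        = I / 2 * (-I) ^ (n + 1).natAbs * ((-I) * (-I) + 1) := by ring
      _ = 0 := by rw [hI]; ring
  · -- n = 0
    simp only [bandCentreGreen, if_true]
    norm_num [Int.natAbs]
    rw [show -(I / 2 * I) + -(I / 2 * I) = -(I * I) by ring, I_mul_I]; norm_num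
  · -- n ≥ 1
    have h1 : (n + 1).natAbs = n.natAbs + 1 := by omega
    have h2 : (n - 1).natAbs + 1 = n.natAbs := by omega
    have hne : n ≠ 0 := ne_of_gt hgt
    simp only [bandCentreGreen, hne, if_false]
    rw [h1, ← h2, pow_succ, pow_succ]
    have hI : (-I) * (-I) = -1 := by rw [neg_mul_neg, I_mul_I]
    calc I / 2 * (-I) ^ (n - 1).natAbs + I / 2 * ((-I) ^ (n - 1).natAbs * -I * -I)
        = I / 2 * (-I) ^ (n - 1).natAbs * (1 + (-I) * (-I)) := by ring
      _ = 0 := by rw [hI]; ring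

/-- The profile generated by the local source `S = 2δ₀ - δ₂ - δ₋₂`: `W(n) = 2G(n) - G(n-2) - G(n+2)`. -/
noncomputable def sourceProfile (n : ℤ) : ℂ :=
  2 * bandCentreGreen n - bandCentreGreen (n - 2) - bandCentreGreen (n + 2)

/-- `W` solves the band-centre equation with source `S`: `W(n-1) + W(n+1) = 2δ_{n,0} - δ_{n,2} - δ_{n,-2}`. -/
theorem sourceProfile_eq (n : ℤ) :
    sourceProfile (n - 1) + sourceProfile (n + 1)
      = 2 * (if n = 0 then (1:ℂ) else 0) - (if n - 2 = 0 then (1:ℂ) else 0)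
        - (if n + 2 = 0 then (1:ℂ) else 0) := by
  have e0 := bandCentreGreen_eq n
  have e1 := bandCentreGreen_eq (n - 2)
  have e2 := bandCentreGreen_eq (n + 2)
  simp only [sourceProfile]
  have a1 : n - 1 - 2 = n - 2 - 1 := by ring
  have a2 : n + 1 - 2 = n - 2 + 1 := by ring
  have a3 : n - 1 + 2 = n + 2 - 1 := by ring
  have a4 : n + 1 + 2 = n + 2 + 1 := by ring
  rw [a1, a2, a3, a4]
  linear_combination 2 * e0 - e1 - e2

/-- `G(1) = 1/2`. -/
theorem bandCentreGreen_one : bandCentreGreen 1 = 1 / 2 := by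
  have h := bandCentreGreen_succ_of_nonneg (le_refl (0:ℤ))
  rw [zero_add, bandCentreGreen_zero] at h
  rw [h, show -I * (I / 2) = -(I * I) / 2 by ring, I_mul_I]; ring

/-- `G(2) = -i/2`. -/
theorem bandCentreGreen_two : bandCentreGreen 2 = -(I / 2) := by
  have h := bandCentreGreen_succ_of_nonneg (show (0:ℤ) ≤ 1 by norm_num)
  rw [show (1:ℤ) + 1 = 2 by norm_num, bandCentreGreen_one] at h
  rw [h]; ring

/-- `G(3) = -1/2`. -/
theorem bandCentreGreen_three : bandCentreGreen 3 = -(1 / 2) := by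
  have h := bandCentreGreen_succ_of_nonneg (show (0:ℤ) ≤ 2 by norm_num)
  rw [show (2:ℤ) + 1 = 3 by norm_num, bandCentreGreen_two] at h
  rw [h, show -I * -(I / 2) = (I * I) / 2 by ring, I_mul_I]; ring

/-- Value of the source profile at the origin: `W(0) = 2i` (the half-chain amplitude is `W(0)/√2 = √2·i`). -/
theorem sourceProfile_zero : sourceProfile 0 = 2 * I := by
  simp only [sourceProfile]
  rw [show (0:ℤ) - 2 = -2 by norm_num, show (0:ℤ) + 2 = 2 by norm_num, bandCentreGreen_neg,
    bandCentreGreen_two, bandCentreGreen_zero]; ring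

/-- Value next to the origin: `W(1) = 1`. -/
theorem sourceProfile_one : sourceProfile 1 = 1 := by
  simp only [sourceProfile]
  rw [show (1:ℤ) - 2 = -1 by norm_num, show (1:ℤ) + 2 = 3 by norm_num, bandCentreGreen_neg,
    bandCentreGreen_one, bandCentreGreen_three]; ring

/-- The outgoing plateau: `W(m) = 2i(-i)^m` for `m ≥ 2`. -/
theorem sourceProfile_far {m : ℕ} (hm : 2 ≤ m) : sourceProfile (m : ℤ) = 2 * I * (-I) ^ m := by
  obtain ⟨k, rfl⟩ := Nat.exists_eq_add_of_le hm
  simp only [sourceProfile, bandCentreGreen]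
  have h0 : ((2 + k : ℕ) : ℤ).natAbs = k + 2 := by omega
  have h1 : (((2 + k : ℕ) : ℤ) - 2).natAbs = k := by omega
  have h2 : (((2 + k : ℕ) : ℤ) + 2).natAbs = k + 4 := by omega
  rw [h0, h1, h2, show 2 + k = k + 2 by ring]
  have hI2 : (-I) ^ 2 = -1 := by rw [neg_sq, I_sq]
  have e2 : (-I) ^ (k + 2) = (-I) ^ k * (-1) := by rw [pow_add, hI2]
  have e4 : (-I) ^ (k + 4) = (-I) ^ k * 1 := by
    rw [pow_add, show (4:ℕ) = 2 + 2 by norm_num, pow_add, hI2]; ring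
  rw [e2, e4]; ring

/-- Link with kernel #202: for `m ≥ 2` the half-chain flux state `-2α i (-i)^m` is `-α · W(m)`. -/
theorem fluxPlateau_eq_neg_alpha_sourceProfile (α : ℝ) {m : ℕ} (hm : 2 ≤ m) :
    -2 * (α : ℂ) * I * (-I) ^ m = -(α : ℂ) * sourceProfile (m : ℤ) := by
  rw [sourceProfile_far hm]; ring

end Summit.AnomalousDissipation.AnomalousDissipation.Theorems
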